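import Literature.NumberTheory.LFunctions.SuzukiSingleOperatorKernelProofs
import Literature.Analysis.SpecialFunctions.LaguerreLaplaceTransform

/-!
# SuzukiWindowsDoorLaplacePower — inverse Laplace transform of a power on a vertical line: `(2π)⁻¹∫_{Im z=b} (½ − iz)^{−(k+1)} e^{−izx} dz = x₊^k e^{−x/2}/k!` (column DBR; RH-FREE)

RH-FREE throughout (no `ζ` at all); nothing here bears on the truth of RH.  The archimedean symbol of Suzuki's single
operator has the Stirling leading term `Θ_θ^arch(s) ≈ (2π)^θ s^{−θ}` (`s = ½ − iz`, [Su20] §3); its exact inverse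
transform along the lines `Im z = b` used by the tree (`Literature.NumberTheory.LFunctions.invFourierLine`) is the
Gamma density.  This file proves, for INTEGER exponents `k + 1 ≥ 2` (the `θ ∈ ℕ` of the column's data ET1e/ET1f) and
every line `b > −½`:

  `invFourierLine (fun z => ((½ − iz)^(k+1))⁻¹) b x = (max x 0)^k · e^{−x/2} / k!`   (all real `x`),

i.e. `x^k e^{−x/2}/k!` for `x > 0` and `0` for `x ≤ 0` — the first brick for VALUES / small-`x` asymptotics of
`g_θ = limArchKernel θ` in the kernel (successor note of DATA.md §ET1g/§ET1h).

* §1 the model function `f(x) = (max x 0)^k e^{−σx}/k!` (`σ = ½ + b > 0`): continuity (`k ≥ 1`), integrability;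
* §2 its Fourier transform `𝓕f(ξ) = ((σ + 2πiξ)^{k+1})⁻¹` (the tree's complex-rate Laplace transform of a monomial
  `Literature.Analysis.SpecialFunctions.integral_pow_mul_cexp_neg_mul_Ioi`), integrability of `𝓕f`
  (`‖·‖ ≤ σ^{1−k}(min(σ²,4π²))⁻¹ (1+ξ²)⁻¹`);
* §3 Fourier inversion (Mathlib `Continuous.fourierInv_fourier_eq`) and the change of variables `u = −2πξ`
  from Mathlib's `𝓕⁻` to the tree's line transform: the identity above, and its two cases;
* §4 the general abscissa: `invFourierLine (fun z => ((c − iz)^(k+1))⁻¹) b x = (max x 0)^k e^{−cx}/k!` whenever `c + b > 0`.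

References: [Su20] M. Suzuki, ASPM 84 (2020) = arXiv:1907.07302, §3 (Stirling for the `γ`-symbol); DLMF 5.9.1.
-/

noncomputable section

-- D-0017: `Summit.<S>.<S>.…` is the designed namespace of a single-problem summit.
set_option linter.dupNamespace false

open MeasureTheory Set Filter Topology Complex

namespace Summit.RiemannHypothesis.RiemannHypothesis.Theorems.SuzukiWindowsDoorLaplacePower

open Literature.NumberTheory.LFunctions
open scoped Real FourierTransform

/-! ## §1 The model function `f(x) = (max x 0)^k e^{−σx}/k!` -/

/-- Continuity of `x ↦ (max x 0)^k e^{−σx}/k!` as a complex-valued function. -/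
theorem continuous_model (k : ℕ) (σ : ℝ) :
    Continuous fun x : ℝ => (((max x 0) ^ k * Real.exp (-(σ * x)) / (k.factorial : ℝ) : ℝ) : ℂ) := by
  fun_prop

/-- On `(−∞, 0]` the model function vanishes (`k ≥ 1`). -/
theorem model_eq_zero_of_nonpos {k : ℕ} (hk : 1 ≤ k) (σ : ℝ) {x : ℝ} (hx : x ≤ 0) :
    (((max x 0) ^ k * Real.exp (-(σ * x)) / (k.factorial : ℝ) : ℝ) : ℂ) = 0 := by
  rw [max_eq_right hx, zero_pow (by omega)]
  simp

/-- On `(0, ∞)` the model function is `x^k e^{−σx}/k!`. -/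
theorem model_eq_of_pos (k : ℕ) (σ : ℝ) {x : ℝ} (hx : 0 < x) :
    (((max x 0) ^ k * Real.exp (-(σ * x)) / (k.factorial : ℝ) : ℝ) : ℂ) =
      (x : ℂ) ^ k * Complex.exp (-((σ : ℂ) * x)) / (k.factorial : ℂ) := by
  rw [max_eq_left hx.le]
  push_cast
  ring_nf

/-- Integrability of the model function on `ℝ` (`σ > 0`). -/
theorem integrable_model {k : ℕ} (hk : 1 ≤ k) {σ : ℝ} (hσ : 0 < σ) :
    Integrable fun x : ℝ => (((max x 0) ^ k * Real.exp (-(σ * x)) / (k.factorial : ℝ) : ℝ) : ℂ) := by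
  have hIoi : IntegrableOn (fun x : ℝ => (((max x 0) ^ k * Real.exp (-(σ * x)) / (k.factorial : ℝ) : ℝ) : ℂ))
      (Ioi 0) := by
    have h := integrableOn_rpow_mul_exp_neg_mul_rpow (s := k) (p := 1)
      (by have : (0 : ℝ) ≤ k := Nat.cast_nonneg k; linarith) le_rfl hσ
    have h' : IntegrableOn (fun x : ℝ => (((x ^ (k : ℝ) * Real.exp (-σ * x ^ (1 : ℝ))) / (k.factorial : ℝ) : ℝ) : ℂ))
        (Ioi 0) := (h.div_const _).ofReal
    refine h'.congr_fun (fun x hx => ?_) measurableSet_Ioi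
    have hx' : 0 < x := hx
    dsimp only
    rw [max_eq_left hx'.le, Real.rpow_natCast, Real.rpow_one, neg_mul]
  have hIic : IntegrableOn (fun x : ℝ => (((max x 0) ^ k * Real.exp (-(σ * x)) / (k.factorial : ℝ) : ℝ) : ℂ))
      (Iic 0) :=
    integrableOn_zero.congr_fun (fun x hx => (model_eq_zero_of_nonpos hk σ hx).symm) measurableSet_Iic
  have h := hIic.union hIoi
  rwa [Iic_union_Ioi, integrableOn_univ] at h

/-! ## §2 The Fourier transform of the model function -/

/-- **`𝓕f(ξ) = ((σ + 2πiξ)^{k+1})⁻¹`** (`σ > 0`): the complex-rate Laplace transform of the monomial. -/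
theorem fourier_model {k : ℕ} (hk : 1 ≤ k) {σ : ℝ} (hσ : 0 < σ) (ξ : ℝ) :
    𝓕 (fun x : ℝ => (((max x 0) ^ k * Real.exp (-(σ * x)) / (k.factorial : ℝ) : ℝ) : ℂ)) ξ =
      (((σ : ℂ) + 2 * π * ξ * I) ^ (k + 1))⁻¹ := by
  have hre : 0 < ((σ : ℂ) + 2 * π * ξ * I).re := by simp; exact hσ
  have hk0 : (k.factorial : ℂ) ≠ 0 := by exact_mod_cast (Nat.factorial_pos k).ne'
  rw [Real.fourier_real_eq_integral_exp_smul,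
    ← setIntegral_eq_integral_of_forall_compl_eq_zero (s := Ioi (0 : ℝ)) (fun x hx => by
      rw [model_eq_zero_of_nonpos hk σ (not_lt.1 hx), smul_zero])]
  have hpt : ∀ x ∈ Ioi (0 : ℝ), Complex.exp (↑(-2 * π * x * ξ) * I) •
      (((max x 0) ^ k * Real.exp (-(σ * x)) / (k.factorial : ℝ) : ℝ) : ℂ) =
      (1 / (k.factorial : ℂ)) * ((x : ℂ) ^ k * Complex.exp (-(((σ : ℂ) + 2 * π * ξ * I) * x))) := by
    intro x hx
    rw [model_eq_of_pos k σ hx, smul_eq_mul]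
    rw [show -(((σ : ℂ) + 2 * π * ξ * I) * x) = -((σ : ℂ) * x) + (↑(-2 * π * x * ξ) * I) by push_cast; ring,
      Complex.exp_add]
    field_simp
  rw [setIntegral_congr_fun measurableSet_Ioi hpt, integral_const_mul,
    Literature.Analysis.SpecialFunctions.integral_pow_mul_cexp_neg_mul_Ioi k hre]
  field_simp

/-- Lower bound `‖σ + 2πiξ‖ ≥ σ` and `‖σ + 2πiξ‖² = σ² + 4π²ξ²`. -/
theorem normSq_rate (σ ξ : ℝ) : ‖(σ : ℂ) + 2 * π * ξ * I‖ ^ 2 = σ ^ 2 + 4 * π ^ 2 * ξ ^ 2 := by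
  rw [Complex.sq_norm, Complex.normSq_apply]
  simp
  ring

/-- **Integrability of `𝓕f`** for `k ≥ 1`, `σ > 0`: `‖((σ+2πiξ)^{k+1})⁻¹‖ ≤ σ^{−(k−1)} (min(σ²,4π²))⁻¹ (1+ξ²)⁻¹`. -/
theorem integrable_fourier_model {k : ℕ} (hk : 1 ≤ k) {σ : ℝ} (hσ : 0 < σ) :
    Integrable fun ξ : ℝ => ((((σ : ℂ) + 2 * π * ξ * I) ^ (k + 1))⁻¹) := by
  set m : ℝ := min (σ ^ 2) (4 * π ^ 2) with hm
  have hmpos : 0 < m := lt_min (by positivity) (by positivity)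
  have hne : ∀ ξ : ℝ, ((σ : ℂ) + 2 * π * ξ * I) ≠ 0 := fun ξ h => by
    have := congrArg Complex.re h
    simp at this
    linarith
  refine ((integrable_inv_one_add_sq.const_mul ((σ ^ (k - 1))⁻¹ * m⁻¹))).mono' ?_
    (Eventually.of_forall fun ξ => ?_)
  · exact (Continuous.inv₀ (by fun_prop) fun ξ => pow_ne_zero _ (hne ξ)).aestronglyMeasurable
  · have hre : ((σ : ℂ) + 2 * π * ξ * I).re = σ := by simp
    have hN : σ ≤ ‖(σ : ℂ) + 2 * π * ξ * I‖ := by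
      have h := Complex.re_le_norm ((σ : ℂ) + 2 * π * ξ * I)
      rwa [hre] at h
    have hN2 : m * (1 + ξ ^ 2) ≤ ‖(σ : ℂ) + 2 * π * ξ * I‖ ^ 2 := by
      rw [normSq_rate]
      have h1 : m ≤ σ ^ 2 := min_le_left _ _
      have h2 : m ≤ 4 * π ^ 2 := min_le_right _ _
      nlinarith [sq_nonneg ξ]
    have hNk : σ ^ (k - 1) * (m * (1 + ξ ^ 2)) ≤ ‖(σ : ℂ) + 2 * π * ξ * I‖ ^ (k + 1) := by
      rw [show k + 1 = (k - 1) + 2 by omega, pow_add]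
      exact mul_le_mul (pow_le_pow_left₀ hσ.le hN _) hN2 (by positivity) (by positivity)
    calc ‖((((σ : ℂ) + 2 * π * ξ * I) ^ (k + 1))⁻¹)‖ = (‖(σ : ℂ) + 2 * π * ξ * I‖ ^ (k + 1))⁻¹ := by
          rw [norm_inv, norm_pow]
      _ ≤ (σ ^ (k - 1) * (m * (1 + ξ ^ 2)))⁻¹ := inv_anti₀ (by positivity) hNk
      _ = (σ ^ (k - 1))⁻¹ * m⁻¹ * (1 + ξ ^ 2)⁻¹ := by rw [mul_inv, mul_inv]; ring

/-! ## §3 Fourier inversion and the line transform of `(½ − iz)^{−(k+1)}` -/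

/-- **Inverse Laplace transform of a power on the line `Im z = b`** (RH-free): for `k ≥ 1` and `b > −½`,
`(2π)⁻¹ ∫_ℝ (½ − i(u+ib))^{−(k+1)} e^{−i(u+ib)x} du = (max x 0)^k e^{−x/2}/k!`, i.e. the tree's
`invFourierLine (fun z => ((½ − iz)^(k+1))⁻¹) b x` is the Gamma density `x^k e^{−x/2}/k!` on `x > 0` and `0` on `x ≤ 0`
(Fourier inversion for `(max x 0)^k e^{−σx}/k!`, `σ = ½ + b`, and the substitution `u = −2πξ`). -/
theorem invFourierLine_inv_pow {k : ℕ} (hk : 1 ≤ k) {b : ℝ} (hb : -1 / 2 < b) (x : ℝ) :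
    invFourierLine (fun z : ℂ => (((1 : ℂ) / 2 - I * z) ^ (k + 1))⁻¹) b x =
      (((max x 0) ^ k * Real.exp (-(x / 2)) / (k.factorial : ℝ) : ℝ) : ℂ) := by
  set σ : ℝ := 1 / 2 + b with hσdef
  have hσ : 0 < σ := by rw [hσdef]; linarith
  set f : ℝ → ℂ := fun y => (((max y 0) ^ k * Real.exp (-(σ * y)) / (k.factorial : ℝ) : ℝ) : ℂ) with hfdef
  have hFf : 𝓕 f = fun ξ : ℝ => ((((σ : ℂ) + 2 * π * ξ * I) ^ (k + 1))⁻¹) := funext (fourier_model hk hσ)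
  have hinv : 𝓕⁻ (𝓕 f) = f :=
    (continuous_model k σ).fourierInv_fourier_eq (integrable_model hk hσ)
      (by rw [hFf]; exact integrable_fourier_model hk hσ)
  have hfx : f x = ∫ v : ℝ, Complex.exp (↑(-2 * π * v * -x) * I) •
      ((((σ : ℂ) + 2 * π * v * I) ^ (k + 1))⁻¹) := by
    have h := congr_fun hinv x
    rw [Real.fourierInv_eq_fourier_neg, Real.fourier_real_eq_integral_exp_smul, hFf] at h
    exact h.symm
  -- the substitution `u = −2π v` turns the line transform into Mathlib's inverse Fourier transform
  have hsub := Measure.integral_comp_mul_left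
    (fun u : ℝ => (((1 : ℂ) / 2 - I * ((u : ℂ) + (b : ℂ) * I)) ^ (k + 1))⁻¹ *
      Complex.exp (-I * ((u : ℂ) + (b : ℂ) * I) * (x : ℂ))) (-(2 * π))
  have habs : |(-(2 * π))⁻¹| = 1 / (2 * π) := by
    rw [abs_inv, abs_neg, abs_of_pos (by positivity)]
    ring
  rw [habs] at hsub
  have hJ : (1 : ℂ) / (2 * (π : ℂ)) * ∫ u : ℝ, (((1 : ℂ) / 2 - I * ((u : ℂ) + (b : ℂ) * I)) ^ (k + 1))⁻¹ *
        Complex.exp (-I * ((u : ℂ) + (b : ℂ) * I) * (x : ℂ)) =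
      ∫ v : ℝ, (((1 : ℂ) / 2 - I * ((((-(2 * π)) * v : ℝ) : ℂ) + (b : ℂ) * I)) ^ (k + 1))⁻¹ *
        Complex.exp (-I * ((((-(2 * π)) * v : ℝ) : ℂ) + (b : ℂ) * I) * (x : ℂ)) := by
    rw [hsub, Complex.real_smul]
    congr 1
    push_cast
    ring
  have hpt : ∀ v : ℝ, (((1 : ℂ) / 2 - I * ((((-(2 * π)) * v : ℝ) : ℂ) + (b : ℂ) * I)) ^ (k + 1))⁻¹ *
        Complex.exp (-I * ((((-(2 * π)) * v : ℝ) : ℂ) + (b : ℂ) * I) * (x : ℂ)) =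
      Complex.exp ((b * x : ℝ) : ℂ) *
        (Complex.exp (↑(-2 * π * v * -x) * I) • ((((σ : ℂ) + 2 * π * v * I) ^ (k + 1))⁻¹)) := by
    intro v
    have h1 : (1 : ℂ) / 2 - I * ((((-(2 * π)) * v : ℝ) : ℂ) + (b : ℂ) * I) = (σ : ℂ) + 2 * π * v * I := by
      rw [hσdef]
      push_cast
      linear_combination (-(b : ℂ)) * I_mul_I
    have h2 : -I * ((((-(2 * π)) * v : ℝ) : ℂ) + (b : ℂ) * I) * (x : ℂ) =
        ((b * x : ℝ) : ℂ) + (↑(-2 * π * v * -x) * I) := by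
      push_cast
      linear_combination (-(b : ℂ) * x) * I_mul_I
    rw [h1, h2, Complex.exp_add, smul_eq_mul]
    ring
  simp only [invFourierLine]
  rw [hJ]
  simp_rw [hpt]
  rw [integral_const_mul, ← hfx, hfdef]
  have hexp : Real.exp (b * x) * Real.exp (-(σ * x)) = Real.exp (-(x / 2)) := by
    rw [← Real.exp_add, hσdef]
    congr 1
    ring
  rw [← Complex.ofReal_exp, ← Complex.ofReal_mul]
  congr 1
  rw [← hexp]
  ring

/-- The case `x ≤ 0`: the line transform of `(½ − iz)^{−(k+1)}` vanishes (Paley–Wiener side). -/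
theorem invFourierLine_inv_pow_of_nonpos {k : ℕ} (hk : 1 ≤ k) {b : ℝ} (hb : -1 / 2 < b) {x : ℝ} (hx : x ≤ 0) :
    invFourierLine (fun z : ℂ => (((1 : ℂ) / 2 - I * z) ^ (k + 1))⁻¹) b x = 0 := by
  rw [invFourierLine_inv_pow hk hb, max_eq_right hx, zero_pow (by omega)]
  simp

/-- The case `x > 0`: the Gamma density `x^k e^{−x/2}/k!`. -/
theorem invFourierLine_inv_pow_of_pos {k : ℕ} (hk : 1 ≤ k) {b : ℝ} (hb : -1 / 2 < b) {x : ℝ} (hx : 0 < x) :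
    invFourierLine (fun z : ℂ => (((1 : ℂ) / 2 - I * z) ^ (k + 1))⁻¹) b x =
      ((x ^ k * Real.exp (-(x / 2)) / (k.factorial : ℝ) : ℝ) : ℂ) := by
  rw [invFourierLine_inv_pow hk hb, max_eq_left hx.le]

/-! ## §4 General abscissa: the line transform of `(c − iz)^{−(k+1)}` -/

/-- **Inverse Laplace transform of a shifted power** (RH-free): for `k ≥ 1`, real `c` and any line `b` with `c + b > 0`,
`invFourierLine (fun z => ((c − iz)^(k+1))⁻¹) b x = (max x 0)^k e^{−cx}/k!` — independent of the line.  (The case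
`c = ½` is `invFourierLine_inv_pow`; the head terms `w^{−θ−n}`, `w = s/2 + 1 = (5/2 − iz)/2`, of the engines'
head-subtracted Bromwich evaluation of `g_θ` (DATA/code/et1c/linA/lineageA.py) are the case `c = 5/2` up to the factor `2^{θ+n}`.) -/
theorem invFourierLine_inv_pow_shift {k : ℕ} (hk : 1 ≤ k) {c b : ℝ} (hcb : 0 < c + b) (x : ℝ) :
    invFourierLine (fun z : ℂ => (((c : ℂ) - I * z) ^ (k + 1))⁻¹) b x =
      (((max x 0) ^ k * Real.exp (-(c * x)) / (k.factorial : ℝ) : ℝ) : ℂ) := by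
  set σ : ℝ := c + b with hσdef
  have hσ : 0 < σ := hcb
  set f : ℝ → ℂ := fun y => (((max y 0) ^ k * Real.exp (-(σ * y)) / (k.factorial : ℝ) : ℝ) : ℂ) with hfdef
  have hFf : 𝓕 f = fun ξ : ℝ => ((((σ : ℂ) + 2 * π * ξ * I) ^ (k + 1))⁻¹) := funext (fourier_model hk hσ)
  have hinv : 𝓕⁻ (𝓕 f) = f :=
    (continuous_model k σ).fourierInv_fourier_eq (integrable_model hk hσ)
      (by rw [hFf]; exact integrable_fourier_model hk hσ)
  have hfx : f x = ∫ v : ℝ, Complex.exp (↑(-2 * π * v * -x) * I) •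
      ((((σ : ℂ) + 2 * π * v * I) ^ (k + 1))⁻¹) := by
    have h := congr_fun hinv x
    rw [Real.fourierInv_eq_fourier_neg, Real.fourier_real_eq_integral_exp_smul, hFf] at h
    exact h.symm
  have hsub := Measure.integral_comp_mul_left
    (fun u : ℝ => ((((c : ℂ) - I * ((u : ℂ) + (b : ℂ) * I)) ^ (k + 1))⁻¹ *
      Complex.exp (-I * ((u : ℂ) + (b : ℂ) * I) * (x : ℂ)))) (-(2 * π))
  have habs : |(-(2 * π))⁻¹| = 1 / (2 * π) := by
    rw [abs_inv, abs_neg, abs_of_pos (by positivity)]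
    ring
  rw [habs] at hsub
  have hJ : (1 : ℂ) / (2 * (π : ℂ)) * ∫ u : ℝ, (((c : ℂ) - I * ((u : ℂ) + (b : ℂ) * I)) ^ (k + 1))⁻¹ *
        Complex.exp (-I * ((u : ℂ) + (b : ℂ) * I) * (x : ℂ)) =
      ∫ v : ℝ, (((c : ℂ) - I * ((((-(2 * π)) * v : ℝ) : ℂ) + (b : ℂ) * I)) ^ (k + 1))⁻¹ *
        Complex.exp (-I * ((((-(2 * π)) * v : ℝ) : ℂ) + (b : ℂ) * I) * (x : ℂ)) := by
    rw [hsub, Complex.real_smul]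
    congr 1
    push_cast
    ring
  have hpt : ∀ v : ℝ, (((c : ℂ) - I * ((((-(2 * π)) * v : ℝ) : ℂ) + (b : ℂ) * I)) ^ (k + 1))⁻¹ *
        Complex.exp (-I * ((((-(2 * π)) * v : ℝ) : ℂ) + (b : ℂ) * I) * (x : ℂ)) =
      Complex.exp ((b * x : ℝ) : ℂ) *
        (Complex.exp (↑(-2 * π * v * -x) * I) • ((((σ : ℂ) + 2 * π * v * I) ^ (k + 1))⁻¹)) := by
    intro v
    have h1 : (c : ℂ) - I * ((((-(2 * π)) * v : ℝ) : ℂ) + (b : ℂ) * I) = (σ : ℂ) + 2 * π * v * I := by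
      rw [hσdef]
      push_cast
      linear_combination (-(b : ℂ)) * I_mul_I
    have h2 : -I * ((((-(2 * π)) * v : ℝ) : ℂ) + (b : ℂ) * I) * (x : ℂ) =
        ((b * x : ℝ) : ℂ) + (↑(-2 * π * v * -x) * I) := by
      push_cast
      linear_combination (-(b : ℂ) * x) * I_mul_I
    rw [h1, h2, Complex.exp_add, smul_eq_mul]
    ring
  simp only [invFourierLine]
  rw [hJ]
  simp_rw [hpt]
  rw [integral_const_mul, ← hfx, hfdef]
  have hexp : Real.exp (b * x) * Real.exp (-(σ * x)) = Real.exp (-(c * x)) := by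
    rw [← Real.exp_add, hσdef]
    congr 1
    ring
  rw [← Complex.ofReal_exp, ← Complex.ofReal_mul]
  congr 1
  rw [← hexp]
  ring

end Summit.RiemannHypothesis.RiemannHypothesis.Theorems.SuzukiWindowsDoorLaplacePower

end
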